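import Literature.AlgebraicGeometry.Resolution.RegularCentreBlowupSeqExtension
import HarnessLib

/-!
# Extending a Cossart–Piltant sequence from an open: the isomorphism locus of the extension

Topic: `Literature/AlgebraicGeometry/Resolution`. A refinement of
`IsRegularCentreBlowupSeq.exists_extension_regular` (`RegularCentreBlowupSeqExtension.lean`:
a sequence `σ : S' → S` of blowing ups along regular centres in the non-locally-principal loci
of `J`, on an open subscheme `j : S ↪ X`, extends to a proper birational `ρ : X' → X` by blowing
up the reduced closures of the centres) recording WHERE the extension is an isomorphism:
**over the complement of the closure of `j(F)`, `F` the non-locally-principal locus of `J`**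
(all centres lie over `F`, `nonPrincipalLocus_comap_subset`, so their closures lie over the
closure of `j(F)`, and a blowing up is an isomorphism off its centre, Görtz–Wedhorn I,
Prop. 13.91 (3)). This is the form of Piltant's Axiom 4 (iii) — "`X' → X` is an isomorphism
above the open where `𝓘` is already locally principal", up to the closure forced by passing
from `Reg X` to `X` — used in Steps 4–5 of the proof of Piltant 2013, Prop. 5.1 ("`f₂,₁` is an
isomorphism above `η⁻¹(X₁ ∖ Φ)`"; "(31) `ε⁻¹(U) ≃ U`"). All PROVED:

* `IsRegularCentreBlowupSeq.exists_extension_isIso` — the conclusions of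
  `exists_extension_regular` together with `IsIso (ρ ∣_ V)` for the open
  `V = X ∖ closure (j F)`.

## References

* O. Piltant, RACSAM 107 (2013), §2 Axiom 4 (iii), Prop. 5.1 Steps 4–5. [Piltant2013]
* U. Görtz, T. Wedhorn, *Algebraic Geometry I*, 2nd ed. (2020), Prop. 13.91 (3). [GortzWedhorn2020]
-/

noncomputable section

open CategoryTheory CategoryTheory.Limits AlgebraicGeometry TopologicalSpace Topology

namespace Literature.AlgebraicGeometry.Resolution

universe u

open Scheme.IdealSheafData

/-- The open complement of the closure of `j(F)`, `F` the non-locally-principal locus of `J`.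
[folklore] -/
def principalOpen {S X : Scheme.{u}} (j : S ⟶ X) (J : S.IdealSheafData) : X.Opens :=
  ⟨(closureImage j (nonPrincipalLocus J : Set S) : Set X)ᶜ,
    (closureImage j (nonPrincipalLocus J : Set S)).isClosed.isOpen_compl⟩

/-- Unfolding. [folklore] -/
@[simp] theorem coe_principalOpen {S X : Scheme.{u}} (j : S ⟶ X) (J : S.IdealSheafData) :
    (principalOpen j J : Set X) = (closure (j '' (nonPrincipalLocus J : Set S)))ᶜ := rfl

/-- A composite restricts to an isomorphism over `U` if both factors do (over `U` and its
preimage). [folklore] -/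
theorem isIso_morphismRestrict_comp {X Y Z : Scheme.{u}} (f : X ⟶ Y) (g : Y ⟶ Z) (U : Z.Opens)
    [h₁ : IsIso (f ∣_ g ⁻¹ᵁ U)] [h₂ : IsIso (g ∣_ U)] : IsIso ((f ≫ g) ∣_ U) := by
  rw [morphismRestrict_comp]
  exact IsIso.comp_isIso' h₁ h₂

/-- **Extension of a Cossart–Piltant sequence from an open subscheme, with its isomorphism
locus.** As `IsRegularCentreBlowupSeq.exists_extension_regular`, and moreover the extension
`ρ : X' → X` is an isomorphism over `X ∖ closure (j F)`, `F ⊆ S` the non-locally-principal locus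
of `J` (Piltant 2013, Axiom 4 (iii): "an isomorphism above the open where `𝓘` is locally
principal"; here after extension to `X` by closures). [cite: Piltant2013, §2 Axiom 4 (iii)] -/
theorem IsRegularCentreBlowupSeq.exists_extension_isIso :
    ∀ {S' S : Scheme.{u}} {σ : S' ⟶ S} {J : S.IdealSheafData}, IsRegularCentreBlowupSeq σ J →
      IsIntegral S → IsLocallyNoetherian S → J ≠ ⊥ →
      ∀ {X : Scheme.{u}} [IsIntegral X] [IsLocallyNoetherian X] (j : S ⟶ X) [IsOpenImmersion j],
        ∃ (X' : Scheme.{u}) (ρ : X' ⟶ X) (j' : S' ⟶ X'), IsOpenImmersion j' ∧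
          IsPullback j' σ ρ j ∧ IsProper ρ ∧ IsIntegral X' ∧ IsBirational ρ ∧
          (∀ (k : Type u) [Field k] (f : X ⟶ Spec (.of k)),
            Motives.IsProjectiveOver (Over.mk f) → Motives.IsProjectiveOver (Over.mk (ρ ≫ f))) ∧
          IsIso (ρ ∣_ principalOpen j J) := by
  intro S' S σ J h
  induction h with
  | nil J =>
    intro _ _ _ X _ _ j _
    refine ⟨X, 𝟙 X, j, inferInstance, IsPullback.of_vert_isIso ⟨by simp⟩, inferInstance,
      inferInstance, isBirational_id X, fun k _ f hf => by rwa [Category.id_comp], inferInstance⟩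
  | @cons S'' S' S τ σ J Y hσ hYint hYreg hY hτ ih =>
    intro hint hN hJ X _ _ j _
    obtain ⟨X', ρ, j', hj', hpb, hprop, hint', hbir, hproj, hiso⟩ := ih hint hN hJ j
    haveI := hj'
    haveI := hint'
    haveI := hprop
    haveI := hiso
    haveI : IsLocallyNoetherian X' := LocallyOfFiniteType.isLocallyNoetherian ρ
    obtain ⟨hintS', hNS', hJ'⟩ := hσ.isIntegral_and_comap_ne_bot hint hN hJ
    haveI := hintS'
    haveI := hNS'
    have hYne : (Y : Set S') ≠ Set.univ := by
      intro hYu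
      apply nonPrincipalLocus_ne_top hJ'
      rw [eq_top_iff]
      intro y _
      exact hY y (by rw [hYu]; trivial)
    let C : X'.IdealSheafData := vanishingIdeal (closureImage j' (Y : Set S'))
    have hC : C.comap j' = vanishingIdeal Y := comap_vanishingIdeal_closureImage j' Y
    have hC0 : C ≠ ⊥ := vanishingIdeal_closureImage_ne_bot j' Y hYne
    have hτ' : IsBlowup τ (C.comap j') := by rw [hC]; exact hτ
    let j'' : S'' ⟶ blowup C := (blowup.isBlowup C).lift (τ ≫ j')
      (by rw [Scheme.IdealSheafData.comap_comp]; exact hτ'.isEffectiveCartier)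
    have hj''π : j'' ≫ blowup.π C = τ ≫ j' := (blowup.isBlowup C).lift_comp _ _
    have hsq : IsPullback j'' τ (blowup.π C) j' :=
      (blowup.isBlowup C).isPullback_of_isOpenImmersion j' hτ' hj''π
    haveI : IsOpenImmersion j'' := MorphismProperty.of_isPullback hsq.flip inferInstance
    haveI : IsProper (blowup.π C) := (blowup.isBlowup C).isProper
    /- the centre lies over the closure of `j(F)`: the blowing up is an isomorphism over
      `ρ⁻¹(X ∖ closure (j F))` -/
    have hcentre : (C.support : Set X') ⊆ ρ ⁻¹' closure (j '' (nonPrincipalLocus J : Set S)) := by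
      rw [coe_support_vanishingIdeal, coe_closureImage]
      refine (closure_minimal ?_ ((isClosed_closure).preimage ρ.continuous))
      rintro _ ⟨y, hy, rfl⟩
      have hy' : σ y ∈ (nonPrincipalLocus J : Set S) := nonPrincipalLocus_comap_subset σ J (hY y hy)
      refine subset_closure ⟨σ y, hy', ?_⟩
      rw [← Scheme.Hom.comp_apply, ← hpb.w, Scheme.Hom.comp_apply]
    haveI : IsIso (blowup.π C ∣_ ρ ⁻¹ᵁ principalOpen j J) := by
      refine (blowup.isBlowup C).isIso_morphismRestrict (Set.disjoint_left.mpr fun x hx hxC => ?_)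
      exact hx (hcentre hxC)
    refine ⟨blowup C, blowup.π C ≫ ρ, j'', inferInstance, hsq.paste_vert hpb, inferInstance,
      (blowup.isBlowup C).isIntegral hC0, ((blowup.isBlowup C).isBirational' hC0).comp hbir,
      fun k _ f hf => ?_, isIso_morphismRestrict_comp _ _ _⟩
    rw [Category.assoc]
    exact (blowup.isBlowup C).isProjectiveOver (ρ ≫ f) (hproj k f hf)

/-- **The refined extension theorem, packaged**: extension `ρ : X' → X` of a Cossart–Piltant
sequence `σ : S' → S` for `J ≠ 0` on a regular integral `S` open in `X`, cartesian over `S`,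
proper, birational, `X'` integral, projective over `k` when `X` is, `S'` regular, every point of
`X'` over `j(S)` in the image of `j'`, and `ρ` an isomorphism over `X ∖ closure (j F)`.
[cite: Piltant2013, §2 Axiom 4] -/
theorem IsRegularCentreBlowupSeq.exists_extension_full {S' S : Scheme.{u}} {σ : S' ⟶ S}
    {J : S.IdealSheafData} (h : IsRegularCentreBlowupSeq σ J) [IsIntegral S]
    [IsLocallyNoetherian S] (hreg : Scheme.IsRegular S) (hJ : J ≠ ⊥) {X : Scheme.{u}}
    [IsIntegral X] [IsLocallyNoetherian X] (j : S ⟶ X) [IsOpenImmersion j] :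
    ∃ (X' : Scheme.{u}) (ρ : X' ⟶ X) (j' : S' ⟶ X'), IsOpenImmersion j' ∧
      IsPullback j' σ ρ j ∧ IsProper ρ ∧ IsIntegral X' ∧ IsBirational ρ ∧
      (∀ (k : Type u) [Field k] (f : X ⟶ Spec (.of k)),
        Motives.IsProjectiveOver (Over.mk f) → Motives.IsProjectiveOver (Over.mk (ρ ≫ f))) ∧
      Scheme.IsRegular S' ∧
      (∀ x' : X', ρ x' ∈ Set.range j → ∃ s' : S', j' s' = x') ∧
      IsIso (ρ ∣_ principalOpen j J) := by
  obtain ⟨X', ρ, j', hj', hpb, hprop, hint', hbir, hproj, hiso⟩ :=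
    h.exists_extension_isIso inferInstance inferInstance hJ j
  refine ⟨X', ρ, j', hj', hpb, hprop, hint', hbir, hproj, h.isRegular hreg, ?_, hiso⟩
  rintro x' ⟨s, hs⟩
  obtain ⟨s', hs'₁, -⟩ := Scheme.Pullback.exists_preimage_pullback x' s hs.symm
  refine ⟨(hpb.isoPullback).inv s', ?_⟩
  rw [← hs'₁, ← Scheme.Hom.comp_apply, IsPullback.isoPullback_inv_fst]

end Literature.AlgebraicGeometry.Resolution

end
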